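import Mathlib
import Summits.ValiantsHypothesis.ValiantsHypothesis.Theorems.GrenetZeonHessianRankCodimTwoBorderFrobeniusEval
import HarnessLib

/-!
# Crux `GrenetZeon.HessianRankCodimTwo` (stmt-ValiantsHypothesis-8061), line `good_plane`, ALL large `n`:
# certificates — shared base

Seat val-width-8061-p1 g2 (interfaces `Cruxes/HessianRankCodimTwo/BorderInterfaces.md`).  Two one-line helpers used
by every generated certificate file `…BorderCertW*/C*/T*.lean`: `N · a ^ k = 0` with `N ≠ 0` forces `a = 0`, and the
arithmetic hypothesis `hK` (every positive integer below `3·10¹⁴` is non-zero in `K`) in numeral form.  VP ≠ VNP is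
not moved by anything here.
-/

noncomputable section

-- single-conjunct layout `Summits/ValiantsHypothesis/ValiantsHypothesis`: duplicated namespace by design
set_option linter.dupNamespace false

namespace Summit.ValiantsHypothesis.ValiantsHypothesis.Theorems.GrenetZeonHessianRankCodimTwo

variable {K : Type*} [Field K]

/-- `N · a ^ k = 0` with `N ≠ 0` forces `a = 0`. [folklore] -/
theorem bord_eq_zero_of_mul_pow {N a : K} {k : ℕ} (hN : N ≠ 0) (h : N * a ^ k = 0) : a = 0 := by
  rcases mul_eq_zero.mp h with h | h
  · exact absurd h hN
  · exact (pow_eq_zero_iff' |>.mp h).1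

/-- A product is non-zero: both factors are. [folklore] -/
theorem bord_left_ne_zero {a b : K} (h : a * b ≠ 0) : a ≠ 0 := left_ne_zero_of_mul h

/-- A product is non-zero: both factors are. [folklore] -/
theorem bord_right_ne_zero {a b : K} (h : a * b ≠ 0) : b ≠ 0 := right_ne_zero_of_mul h

/-- Cancelling a non-zero factor: `f · E = 0`, `f ≠ 0` give `E = 0`. [folklore] -/
theorem bord_cancel {f E : K} (hf : f ≠ 0) (h : f * E = 0) : E = 0 :=
  (mul_eq_zero.mp h).resolve_left hf

end Summit.ValiantsHypothesis.ValiantsHypothesis.Theorems.GrenetZeonHessianRankCodimTwo
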